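import Mathlib
import HarnessLib
import Summits.NavierStokesRegularity.NavierStokesRegularity.Theorems.PoloidalWindowDoorPoloidalWindowRigidityLargeScaleEnergyDecay
import Summits.NavierStokesRegularity.NavierStokesRegularity.Theorems.PoloidalWindowDoorPoloidalWindowRigidityPressureOscillation

/-!
# Route `PoloidalWindowDoor`, crux `PoloidalWindowRigidity` (K2, stmt-NavierStokesRegularity-19708) —
# LARGE-SCALE ENERGY DECAY OF THE TYPE-I MILD CLASS, UNCONDITIONALLY

Cell ns-regularity-ideate, seat nsreg-p7 (gen 6, third worker under the K2 lead; `--supports stmt-…-19708`).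
The K2 lead's cell-level theorem (K2P1-M11-NOTES §5; kernel forms `…LargeScaleEnergy` by the lead and
`…LargeScaleEnergyDecay` by nsreg-p7 g5, both CONDITIONAL on the pressure hypothesis (F1)) made unconditional:
for every profile `v` of the route's Type-I class (`‖v(t,x)‖ ≤ C/√(−t)`, continuous, unit-viscosity Oseen-mild
between negative times, divergence free), every `t < 0` and every `R ≥ 1`,

  `∫_{B(0,R)} |v(t,x)|² dx ≤ |B̄(0,2R)| · ( C²/(R²(−t)) + 2C₂C² log R / R² + 2C₁(C³ + 2C·K C²)/(R√(−t)) )`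

(`largeScale_energy_le`; `C₁, C₂` the tree's cut-off constants, `K` the universal constant of (F1)).  Since
`|B̄(0,2R)| = 8|B(0,R)|`, the mean of `|v(t)|²` over `B(0,R)` is `O(log R/R²) + O(1/(R√(−t)))` → 0: Type-I
profiles are at most «sheet-like» in energy density on every slice.  Inputs: p7 g5's `energy_ball_le_parabolic`
(integrated local energy identity against `cutoff R` between the ancient time `tR²` and `t`), the classical
pressure of the class (`IsTypeIAncientMild.exists_isClassicalNSSolutionOn_Ioo`), and (F1) =
`…PressureOscillation.exists_integral_abs_sub_le_class` — itself resting on the pressure-gradient identity of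
bounded Oseen-mild solutions (`…PressureGradientIdentity`) and the large-scale momentum conservation
(`…LargeScaleMomentum`).  The Oseen-mild identity (M) is used exactly there; the drifting witnesses of the
negative lane (affine pressure) violate the conclusion.

WHAT THIS IS NOT: not a claim about Navier–Stokes regularity and not the open residue S2⁗ — a whole-class
averaged spatial-decay theorem (bears_on LADDER-NS N0 via crux K2 = stmt-19708 and every Type-I-class route).
-/

noncomputable section

-- the summit and its single sub-problem share the name (CONVENTIONS §1), as in every Theorems file
set_option linter.dupNamespace false

namespace Summit.NavierStokesRegularity.NavierStokesRegularity.Theorems.PoloidalWindowDoorPoloidalWindowRigidityLargeScaleEnergyDecayHolds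

open MeasureTheory Set Function Filter Topology Metric InnerProductSpace
open scoped RealInnerProductSpace Laplacian ContDiff
open Literature.Analysis Literature.Analysis.FluidPDE Literature.Analysis.UnboundedOperators
open Summit.NavierStokesRegularity.NavierStokesRegularity.Theorems.PoloidalWindowDoorPoloidalWindowRigidityLargeScaleEnergyDecay
open Summit.NavierStokesRegularity.NavierStokesRegularity.Theorems.PoloidalWindowDoorPoloidalWindowRigidityPressureOscillation
open Summit.NavierStokesRegularity.NavierStokesRegularity.Theorems.PoloidalWindowDoorPoloidalWindowRigidityWindow

variable {C : ℝ} {v : ℝ → EuclideanSpace ℝ (Fin 3) → EuclideanSpace ℝ (Fin 3)}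

/-- **LARGE-SCALE ENERGY DECAY OF THE TYPE-I MILD CLASS (unconditional).** For a profile of the route's Type-I
class there are constants `K, C₁, C₂ ≥ 0` (universal: the (F1) constant and the cut-off constants) such that for
all `t < 0` and `R ≥ 1`,
`∫_{B(0,R)} |v(t)|² ≤ |B̄(0,2R)| (C²/(R²(−t)) + 2C₂C² log R/R² + 2C₁(C³ + 2C(KC²))/(R√(−t)))`. -/
theorem largeScale_energy_le (hrate : HasTypeITimeDecay C v)
    (hcont : ContinuousOn (uncurry v) (Iio (0 : ℝ) ×ˢ univ))
    (hmild : ∀ s t : ℝ, s < t → t < 0 → ∀ x,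
      v t x = heatExtension (v s) (t - s) x - oseenDuhamel 1 s v v t x)
    (hdiv : ∀ t < 0, VectorCalculus.IsDivFree (v t)) :
    ∃ K C₁ C₂ : ℝ, 0 ≤ K ∧ 0 ≤ C₁ ∧ 0 ≤ C₂ ∧ ∀ t < 0, ∀ R : ℝ, 1 ≤ R →
      ∫ x in ball (0 : EuclideanSpace ℝ (Fin 3)) R, ‖v t x‖ ^ 2 ≤
        volume.real (closedBall (0 : EuclideanSpace ℝ (Fin 3)) (2 * R)) *
          (C ^ 2 / (R ^ 2 * (-t)) + 2 * C₂ * C ^ 2 * Real.log R / R ^ 2 +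
            2 * C₁ * (C ^ 3 + 2 * C * (K * C ^ 2)) / (R * Real.sqrt (-t))) := by
  obtain ⟨K, hK0, hK⟩ := exists_integral_abs_sub_le_class
  obtain ⟨C₁, hC₁0, hC₁⟩ := exists_norm_fderiv_cutoff_le (E := EuclideanSpace ℝ (Fin 3))
  obtain ⟨C₂, hC₂0, hC₂⟩ := exists_abs_laplacian_cutoff_le (E := EuclideanSpace ℝ (Fin 3))
  have hC0 : 0 ≤ C := by
    have h := hrate (-1) (by norm_num) 0
    rw [neg_neg, Real.sqrt_one, div_one] at h
    exact (norm_nonneg _).trans h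
  have hAM : IsTypeIAncientMild C v := isTypeIAncientMild_of_class hrate hcont hmild hdiv
  refine ⟨K, C₁, C₂, hK0, hC₁0, hC₂0, fun t ht R hR => ?_⟩
  have hR0 : 0 < R := by linarith
  -- a window `(tR² − 1, 0)` carrying a classical pressure
  set t₀ : ℝ := t * R ^ 2 - 1 with ht₀
  have hR2 : 1 ≤ R ^ 2 := one_le_pow₀ hR
  have htR : t * R ^ 2 ≤ t := by nlinarith
  have ht₀0 : t₀ < 0 := by rw [ht₀]; linarith
  obtain ⟨p, hcl⟩ := hAM.exists_isClassicalNSSolutionOn_Ioo ht₀0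
  have hI : Icc (t * R ^ 2) t ⊆ Ioo t₀ 0 := fun s hs => ⟨by rw [ht₀]; linarith [hs.1], by linarith [hs.2]⟩
  have hCb : ∀ s ∈ Icc (t * R ^ 2) t, ∀ x, ‖v s x‖ ≤ C / Real.sqrt (-s) := fun s hs x =>
    hrate s (by linarith [hs.2]) x
  have hosc : ∀ s ∈ Icc (t * R ^ 2) t, ∃ c : ℝ,
      ∫ x in closedBall (0 : EuclideanSpace ℝ (Fin 3)) (2 * R), |p s x - c| ≤
        K * C ^ 2 / (-s) * volume.real (closedBall (0 : EuclideanSpace ℝ (Fin 3)) (2 * R)) := by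
    intro s hs
    obtain ⟨κ, hκ⟩ := hK hrate hmild ht₀0 hcl s (hI hs) 0 (2 * R) (by linarith)
    exact ⟨κ, hκ.trans (le_of_eq (by ring))⟩
  exact energy_ball_le_parabolic hcl isOpen_Ioo ht hR hI hC0 (by positivity) hCb hosc (hC₁ R hR0) (hC₂ R hR0)

/-- **The mean energy over large balls tends to zero on every slice** (the qualitative corollary): for a profile
of the Type-I class and `t < 0`, `(1/|B(0,R)|) ∫_{B(0,R)} |v(t)|² → 0` as `R → ∞` — the bound of
`largeScale_energy_le` divided by `|B(0,R)| = |B̄(0,2R)|/8`, with `log R/R² → 0` and `1/R → 0`. Stated as the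
explicit `O(·)` inequality `∫_{B(0,R)}|v(t)|² ≤ 8 |B(0,R)| ε(R)` with `ε(R) → 0`. -/
theorem largeScale_meanEnergy_le (hrate : HasTypeITimeDecay C v)
    (hcont : ContinuousOn (uncurry v) (Iio (0 : ℝ) ×ˢ univ))
    (hmild : ∀ s t : ℝ, s < t → t < 0 → ∀ x,
      v t x = heatExtension (v s) (t - s) x - oseenDuhamel 1 s v v t x)
    (hdiv : ∀ t < 0, VectorCalculus.IsDivFree (v t)) :
    ∃ K C₁ C₂ : ℝ, 0 ≤ K ∧ 0 ≤ C₁ ∧ 0 ≤ C₂ ∧ ∀ t < 0, ∀ R : ℝ, 1 ≤ R →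
      ∫ x in ball (0 : EuclideanSpace ℝ (Fin 3)) R, ‖v t x‖ ^ 2 ≤
        8 * volume.real (ball (0 : EuclideanSpace ℝ (Fin 3)) R) *
          (C ^ 2 / (R ^ 2 * (-t)) + 2 * C₂ * C ^ 2 * Real.log R / R ^ 2 +
            2 * C₁ * (C ^ 3 + 2 * C * (K * C ^ 2)) / (R * Real.sqrt (-t))) := by
  obtain ⟨K, C₁, C₂, hK0, hC₁0, hC₂0, h⟩ := largeScale_energy_le hrate hcont hmild hdiv
  refine ⟨K, C₁, C₂, hK0, hC₁0, hC₂0, fun t ht R hR => ?_⟩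
  have hR0 : 0 ≤ R := by linarith
  have hvol : volume.real (closedBall (0 : EuclideanSpace ℝ (Fin 3)) (2 * R)) =
      8 * volume.real (ball (0 : EuclideanSpace ℝ (Fin 3)) R) := by
    rw [measureReal_def, measureReal_def, Measure.addHaar_closedBall_eq_addHaar_ball,
      Measure.addHaar_ball volume (0 : EuclideanSpace ℝ (Fin 3)) (by positivity : (0 : ℝ) ≤ 2 * R),
      Measure.addHaar_ball volume (0 : EuclideanSpace ℝ (Fin 3)) hR0, finrank_euclideanSpace_fin,
      ENNReal.toReal_mul, ENNReal.toReal_mul, ENNReal.toReal_ofReal (by positivity),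
      ENNReal.toReal_ofReal (by positivity)]
    ring
  rw [← hvol]
  exact h t ht R hR

end Summit.NavierStokesRegularity.NavierStokesRegularity.Theorems.PoloidalWindowDoorPoloidalWindowRigidityLargeScaleEnergyDecayHolds

end
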